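import Summits.BirchSwinnertonDyer.BirchSwinnertonDyer.Theorems.SignedLowerHalvesSmallImageLowerHalfBothSignsRttJunctionLambdaStrictDual
import HarnessLib

/-!
# Route `SignedLowerHalves`, crux L `SmallImageLowerHalfBothSigns` (stmt-BirchSwinnertonDyer-23599), line `rtt_w3` v22 → v23 — stub S3β (row J4′, Poitou–Tate half):
# PEELING THE PONTRYAGIN LAYER OFF S3β — `λ(coker gX) = λ(Y′) + λ((Sel_{str,v} ⧸ Sel_{str})^∨)`, so that S3β ⟸ S3β″
# «`λ(Λ_𝒪/(E)) ≤ λ((Sel_{str,v} ⧸ Sel_{str})^∨) + λ(I.H ⧸ B′)`» (= "λ of the depletion ≤ λ of the `S₀K`-localisation image of the `v`-strict Selmer group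
# + λ of the `S₀K`-localisation image of the compact global classes": Poitou–Tate at `S₀K` + the local count, with NO `gX`, `DQ`, pinned `Λ_𝒪`-structures left)

Stub hand `bsd-inputs-lambda-p1` g0 under LEAD `cruxlead-stmt-BirchSwinnertonDyer-23599` g12/g13 (cell `bsd-ssimc`); helper `--supports stmt-BirchSwinnertonDyer-23599`.
DEFINITIONS WITH BODIES (`locImageQuot`, `conjLocImage`, `locImageDualModule`, `inflHom`, `resAtHom`) + THEOREMS; no named fact, no instance, no `sorry`.
HONEST FRAMING: pure Pontryagin/`Λ`-bookkeeping on the A-side; the arithmetic of S3β (the semilocal `Hloc`, Poitou–Tate exactness in the tower, `𝐇¹_Iw(K_w,T*) ⊇ Λ_𝒪/(P_w)`)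
is NOT touched; crux L / E2 / S3 / BSD remain OPEN and are proved for NO curve.

* §1 `conjSignedSat_mem_strictAt` — `Sel_{str,v} = ker loc_v` is stable under EVERY `conj_σ` when `v` is non-split in `K_∞/K` (the decomposition group surjects onto `Γ`;
  `conjH1_of_mem_holds` + `locH1_comp_conjH1`); hence ★ `strictSelmer_union_primes_eq`: `Sel_{str at S₀K ∪ {w ∣ p}} = Sel_{str,v} ⊓ Sel_{str at S₀K}` (`p` inert: `{w ∣ p} = {v}`).
* §2 `locImageQuot := Sel_{str,v} ⧸ Sel_{str}` (≅ the image of `Sel_{str,v}` under the `S₀K`-localisations, BY DEFINITION of `Sel_str`), `conjLocImage`, its forced `Λ`-structure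
  `locImageDualModule` on `(locImageQuot)^∨ = Hom(·, ℚ/ℤ)`.
* §3 the dual short exact sequence `0 → (Sel_{str,v}/Sel_str)^∨ —infl→ Sel_{str,v}^∨ —res→ Sel_str^∨ = Y′ → 0` (`ℚ/ℤ` injective), all maps `Λ`-linear (forcing lemma), and
  `Sel_{str,v}^∨ ≅ coker gX` `Λ`-linearly (`resAtHom : Dψ.X ↠ Sel_{str,v}^∨` with kernel `range gX`: `map_toDual_range_gXHom` + exactness of `Hom(−, ℚ/ℤ)`).
* §4 ★★ `lambdaInvariant_coker_eq_strictDual_add_locImageDual(_O)`: `λ(Dψ.X ⧸ range gX) = λ(Y′) + λ((Sel_{str,v}/Sel_str)^∨)` (`Λ`- and the stub's `Λ_𝒪`-currency), and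
  ★★ `charRoadLambda_ineq_of_locImage_ineq`: the S3β inequality `e + λ(Y′) ≤ λ(Dψ.X ⧸ range gX) + q` from S3β″ `e ≤ λ((Sel_{str,v}/Sel_str)^∨) + q`.
References: [Kobayashi2003] Thm. 7.3 i); [Rubin2000] Thm. 1.7.3; [GreenbergLNM1716] §1; [Washington1997] §13.2.
-/

set_option autoImplicit false
set_option linter.dupNamespace false -- D-0017: single-problem summit, the namespace repeats the problem name by design
noncomputable section

open scoped Classical
open NumberField IsDedekindDomain Field

universe u

namespace Summit.BirchSwinnertonDyer.BirchSwinnertonDyer.Theorems.SmallImageRttD2Seq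

open Literature.NumberTheory.EllipticCurves Literature.NumberTheory.EllipticCurves.Kobayashi2003
  Literature.NumberTheory.EllipticCurves.GreenbergVatsal2000 Literature.NumberTheory.GaloisRepresentations
  Summit.BirchSwinnertonDyer.BirchSwinnertonDyer.Theorems.SmallImageCharSignedSelmer

/-! ## §1. `Sel_{str,v}` is stable under every conjugation (`v` non-split) -/

section ConjStable

variable {K : Type u} [Field K] [NumberField K] {p : ℕ} [Fact p.Prime] (κ : ZpExtension K p)
  (M : Type u) [AddCommGroup M] [DistribMulAction (absoluteGaloisGroup K) M] [TopologicalSpace M] [DiscreteTopology M]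
  (R : Type*) [Ring R] [Module R M] (V : WeierstrassCurve K) (j : V.geomPrimaryTorsion p →+ M) (S₀ : Set (HeightOneSpectrum (𝓞 K))) (ε : ℤˣ)
  (v : HeightOneSpectrum (𝓞 K)) [DistribMulAction (absoluteGaloisGroup (v.adicCompletion K)) M]
  (hres : ∀ (σ : absoluteGaloisGroup (v.adicCompletion K)) (m : M), σ • m = resGalOfEmb (closureEmb (K := K) (v.adicCompletion K)) σ • m)
  (hv : (p : 𝓞 K) ∈ v.asIdeal)

/-- ★ **`Sel_{str,v} = ker loc_v` is stable under every `conj_σ`, `σ ∈ Γ_K`, when `v` is NON-SPLIT in `K_∞/K`**: the decomposition group of the chosen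
embedding surjects onto `Γ = Γ_K / Gal(K̄/K_∞)` (`AcSigned.IsNonsplitIn`), so `σ = res_ι(δ) · h` with `h ∈ Gal(K̄/K_∞)` acting trivially (`conjH1_of_mem_holds`)
and `loc_v ∘ conj_{res_ι δ} = conj_δ ∘ loc_v` (`locH1_comp_conjH1`). (There is ONE prime of `K_∞` above `v`.) [cite: SerreLocalFields1979, VII.§5 Prop. 3]
[cite: NeukirchSchmidtWingberg2008, I.§5] -/
theorem conjSignedSat_mem_strictAt (hns : AcSigned.IsNonsplitIn κ v) (σ : absoluteGaloisGroup K)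
    {s : signedTransportSelmerInftySat κ M R V j S₀ ε} (hs : s ∈ strictAt κ M R V j S₀ ε v hres hv) :
    conjSignedSat κ M R V j S₀ ε σ s ∈ strictAt κ M R V j S₀ ε v hres hv := by
  haveI := normal_localSubgroupOfEmb_kerSubgroup κ v
  rw [mem_strictAt_iff] at hs ⊢
  obtain ⟨δ, hδ⟩ := hns (κ σ)
  have hδ' : κ (resGalOfEmb (closureEmb (K := K) (v.adicCompletion K)) δ) = κ σ := hδ
  have hmem : (resGalOfEmb (closureEmb (K := K) (v.adicCompletion K)) δ)⁻¹ * σ ∈ κ.kerSubgroup := by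
    rw [ZpExtension.mem_kerSubgroup, map_mul, map_inv, hδ', inv_mul_cancel]
  have hconj : conjH1 κ.kerSubgroup M σ = conjH1 κ.kerSubgroup M (resGalOfEmb (closureEmb (K := K) (v.adicCompletion K)) δ) := by
    conv_lhs => rw [← mul_inv_cancel_left (resGalOfEmb (closureEmb (K := K) (v.adicCompletion K)) δ) σ, conjH1_mul_holds κ.kerSubgroup M,
      conjH1_of_mem_holds κ.kerSubgroup M hmem, AddMonoidHom.comp_id]
  rw [coe_conjSignedSat_apply, hconj, ← AddMonoidHom.comp_apply, locH1_comp_conjH1, AddMonoidHom.comp_apply, hs, map_zero]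

end ConjStable

section Inert

variable {K : Type u} [Field K] [NumberField K] (p : ℕ) (v : HeightOneSpectrum (𝓞 K))

/-- For `v.asIdeal = (p)` (an inert prime), the places above `p` are exactly `{v}`. [folklore] -/
theorem setOf_natCast_mem_eq_singleton (hvp : v.asIdeal = Ideal.span {((p : ℕ) : 𝓞 K)}) :
    {w : HeightOneSpectrum (𝓞 K) | ((p : ℕ) : 𝓞 K) ∈ w.asIdeal} = {v} := by
  ext w
  simp only [Set.mem_setOf_eq, Set.mem_singleton_iff]
  constructor
  · intro hw
    have hle : v.asIdeal ≤ w.asIdeal := by rw [hvp, Ideal.span_singleton_le_iff_mem]; exact hw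
    exact (HeightOneSpectrum.ext (v.isMaximal.eq_of_le w.isPrime.ne_top hle)).symm
  · rintro rfl; rw [hvp]; exact Ideal.mem_span_singleton_self _

end Inert

section UnionPrimes

variable {K : Type u} [Field K] [NumberField K] {p : ℕ} [Fact p.Prime] (κ : ZpExtension K p)
  (M : Type u) [AddCommGroup M] [DistribMulAction (absoluteGaloisGroup K) M] [TopologicalSpace M] [DiscreteTopology M]
  (R : Type*) [Ring R] [Module R M] (V : WeierstrassCurve K) (j : V.geomPrimaryTorsion p →+ M) (S₀ : Set (HeightOneSpectrum (𝓞 K))) (ε : ℤˣ)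
  (v : HeightOneSpectrum (𝓞 K)) (hv : (p : 𝓞 K) ∈ v.asIdeal)

/-- ★ **`Sel_{str at S₁ ∪ {w ∣ p}} = Sel_{str,v} ⊓ Sel_{str at S₁}`** for the canonical restricted action at the inert `v` (`{w ∣ p} = {v}`), `v` non-split: the `v`-part of
the strictness condition (all conjugates) is `ker loc_v` (§1). [cite: Kobayashi2003, Thm. 7.3 i)] -/
theorem strictSelmer_union_primes_eq (hvp : v.asIdeal = Ideal.span {((p : ℕ) : 𝓞 K)}) (hns : AcSigned.IsNonsplitIn κ v) (S₁ : Set (HeightOneSpectrum (𝓞 K))) :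
    letI := localAction (closureEmb (K := K) (v.adicCompletion K)) M
    strictSelmer κ M R V j S₀ ε (S₁ ∪ {w : HeightOneSpectrum (𝓞 K) | ((p : ℕ) : 𝓞 K) ∈ w.asIdeal}) =
      strictAt κ M R V j S₀ ε v (fun _ _ ↦ rfl) hv ⊓ strictSelmer κ M R V j S₀ ε S₁ := by
  letI := localAction (closureEmb (K := K) (v.adicCompletion K)) M
  rw [setOf_natCast_mem_eq_singleton p v hvp]
  apply le_antisymm
  · exact le_inf (strictSelmer_le_strictAt κ M R V j S₀ ε (Set.mem_union_right S₁ (Set.mem_singleton v)) hv)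
      (strictSelmer_anti κ M R V j S₀ ε Set.subset_union_left)
  · intro s hs'
    obtain ⟨hsv, hs⟩ := AddSubgroup.mem_inf.mp hs'
    rw [mem_strictSelmer_iff] at hs ⊢
    rintro w (hw | hw) σ
    · exact hs w hw σ
    · rw [Set.mem_singleton_iff] at hw
      subst hw
      have h := conjSignedSat_mem_strictAt κ M R V j S₀ ε w (fun _ _ ↦ rfl) hv hns σ hsv
      rw [mem_strictAt_iff, coe_conjSignedSat_apply] at h
      exact h

end UnionPrimes


/-! ## §2. The localisation image `Sel_{str,v} ⧸ Sel_str` and its dual -/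

section LocImage

variable {K : Type u} [Field K] [NumberField K] {p : ℕ} [Fact p.Prime] (κ : ZpExtension K p)
  (M : Type u) [AddCommGroup M] [DistribMulAction (absoluteGaloisGroup K) M] [TopologicalSpace M] [DiscreteTopology M]
  (R : Type*) [Ring R] [Module R M] (V : WeierstrassCurve K) (j : V.geomPrimaryTorsion p →+ M) (S₀ : Set (HeightOneSpectrum (𝓞 K))) (ε : ℤˣ)
  (v : HeightOneSpectrum (𝓞 K)) [DistribMulAction (absoluteGaloisGroup (v.adicCompletion K)) M]
  (hres : ∀ (σ : absoluteGaloisGroup (v.adicCompletion K)) (m : M), σ • m = resGalOfEmb (closureEmb (K := K) (v.adicCompletion K)) σ • m)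
  (hv : (p : 𝓞 K) ∈ v.asIdeal) (S₁ : Set (HeightOneSpectrum (𝓞 K)))

/-- `Sel_{str at S₁}` seen inside `Sel_{str,v}` (assuming `Sel_{str at S₁} ≤ Sel_{str,v}`). [folklore] -/
def strictInStrictAt : AddSubgroup (strictAt κ M R V j S₀ ε v hres hv) :=
  (strictSelmer κ M R V j S₀ ε S₁).addSubgroupOf (strictAt κ M R V j S₀ ε v hres hv)

/-- ★ **The localisation image `Sel_{str,v} ⧸ Sel_{str}`** — by definition of `Sel_str` (the kernel of all localisations above `S₁`) this IS the image of the `v`-strict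
Selmer group under the `S₁`-localisations, the A-side term of the compact Poitou–Tate sequence at `S₁`. [cite: Rubin2000, Thm. 1.7.3] [cite: Kobayashi2003, Thm. 7.3 i)] -/
abbrev locImageQuot : Type u :=
  strictAt κ M R V j S₀ ε v hres hv ⧸ strictInStrictAt κ M R V j S₀ ε v hres hv S₁

/-- `conj_τ` on `Sel_{str,v}` (restriction of `conjSignedSat τ`; needs `v` non-split). [cite: GreenbergVatsal2000, §2 p. 17] -/
def conjStrictAtEnd (hns : AcSigned.IsNonsplitIn κ v) (τ : absoluteGaloisGroup K) : AddMonoid.End (strictAt κ M R V j S₀ ε v hres hv) :=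
  (((conjSignedSat κ M R V j S₀ ε τ) : signedTransportSelmerInftySat κ M R V j S₀ ε →+ _).restrict (strictAt κ M R V j S₀ ε v hres hv)).codRestrict
    (strictAt κ M R V j S₀ ε v hres hv) fun s ↦ conjSignedSat_mem_strictAt κ M R V j S₀ ε v hres hv hns τ s.2

/-- Unfolding (definitional). [folklore] -/
@[simp] theorem coe_conjStrictAtEnd_apply (hns : AcSigned.IsNonsplitIn κ v) (τ : absoluteGaloisGroup K) (s : strictAt κ M R V j S₀ ε v hres hv) :
    ((conjStrictAtEnd κ M R V j S₀ ε v hres hv hns τ s : strictAt κ M R V j S₀ ε v hres hv) : signedTransportSelmerInftySat κ M R V j S₀ ε) =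
      conjSignedSat κ M R V j S₀ ε τ s := rfl

/-- `conj_τ` descends to `Sel_{str,v} ⧸ Sel_str` (`Sel_str` is `conj`-stable). [cite: GreenbergVatsal2000, §2 p. 17] -/
def conjLocImage (hns : AcSigned.IsNonsplitIn κ v) (τ : absoluteGaloisGroup K) : AddMonoid.End (locImageQuot κ M R V j S₀ ε v hres hv S₁) :=
  QuotientAddGroup.map _ _ (conjStrictAtEnd κ M R V j S₀ ε v hres hv hns τ) fun s hs ↦ by
    change ((conjStrictAtEnd κ M R V j S₀ ε v hres hv hns τ s : strictAt κ M R V j S₀ ε v hres hv) : signedTransportSelmerInftySat κ M R V j S₀ ε) ∈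
      strictSelmer κ M R V j S₀ ε S₁
    rw [coe_conjStrictAtEnd_apply]
    exact conjSignedSat_mem_strictSelmer κ M R V j S₀ ε S₁ τ hs

/-- `conjLocImage τ (mk s) = mk (conj_τ s)` (definitional). [folklore] -/
theorem conjLocImage_mk (hns : AcSigned.IsNonsplitIn κ v) (τ : absoluteGaloisGroup K) (s : strictAt κ M R V j S₀ ε v hres hv) :
    conjLocImage κ M R V j S₀ ε v hres hv S₁ hns τ (QuotientAddGroup.mk s) = QuotientAddGroup.mk (conjStrictAtEnd κ M R V j S₀ ε v hres hv hns τ s) := rfl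

/-- Powers of `conjStrictAtEnd τ − 1` on underlying classes. [folklore] -/
theorem coe_conjStrictAtEnd_sub_one_pow_apply (hns : AcSigned.IsNonsplitIn κ v) (τ : absoluteGaloisGroup K) (m : ℕ) (s : strictAt κ M R V j S₀ ε v hres hv) :
    ((((conjStrictAtEnd κ M R V j S₀ ε v hres hv hns τ - 1) ^ m) s : strictAt κ M R V j S₀ ε v hres hv) : signedTransportSelmerInftySat κ M R V j S₀ ε) =
      ((conjSignedSat κ M R V j S₀ ε τ - 1) ^ m) (s : signedTransportSelmerInftySat κ M R V j S₀ ε) := by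
  induction m generalizing s with
  | zero => rfl | succ m ih => rw [pow_succ, pow_succ, AddMonoid.End.coe_mul, AddMonoid.End.coe_mul, Function.comp_apply, Function.comp_apply, ih]; rfl

/-- Powers of `conjLocImage τ − 1` on classes: `(ψ_Q)^m (mk s) = mk ((ψ_v)^m s)`. [folklore] -/
theorem conjLocImage_sub_one_pow_mk (hns : AcSigned.IsNonsplitIn κ v) (τ : absoluteGaloisGroup K) (m : ℕ) (s : strictAt κ M R V j S₀ ε v hres hv) :
    ((conjLocImage κ M R V j S₀ ε v hres hv S₁ hns τ - 1) ^ m) (QuotientAddGroup.mk s) =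
      QuotientAddGroup.mk (((conjStrictAtEnd κ M R V j S₀ ε v hres hv hns τ - 1) ^ m) s) := by
  induction m generalizing s with
  | zero => rfl
  | succ m ih => rw [pow_succ, pow_succ, AddMonoid.End.coe_mul, AddMonoid.End.coe_mul, Function.comp_apply, Function.comp_apply]; exact ih _

variable {M}

/-- `conj_γ − 1` is locally nilpotent on `Sel_{str,v}` (inherited). [cite: GreenbergLNM1716, §1 (after Conj. 1.3)] -/
theorem isLocNil_conjStrictAtEnd_sub_one (hns : AcSigned.IsNonsplitIn κ v) (htor : ∀ m : M, ∃ k : ℕ, p ^ k • m = 0)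
    (hstab : ∀ m : M, IsOpen (MulAction.stabilizer (absoluteGaloisGroup K) m : Set (absoluteGaloisGroup K))) {γ : absoluteGaloisGroup K} (hγ : κ.IsTopGenerator γ) :
    IwasawaDual.IsLocNil p (conjStrictAtEnd κ M R V j S₀ ε v hres hv hns γ - 1) := by
  have h := isLocNil_conjSignedSat_sub_one κ R V j S₀ ε htor hstab hγ
  refine ⟨fun s ↦ ?_, fun s ↦ ?_⟩
  · obtain ⟨k, hk⟩ := h.torsion (s : signedTransportSelmerInftySat κ M R V j S₀ ε)
    exact ⟨k, Subtype.ext (by rw [AddSubgroupClass.coe_nsmul]; exact hk)⟩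
  · obtain ⟨N, hN⟩ := h.nil (s : signedTransportSelmerInftySat κ M R V j S₀ ε)
    exact ⟨N, Subtype.ext (by rw [coe_conjStrictAtEnd_sub_one_pow_apply]; exact hN)⟩

/-- `conj_γ − 1` is locally nilpotent on `Sel_{str,v} ⧸ Sel_str` and the group is `p`-primary. [cite: GreenbergLNM1716, §1 (after Conj. 1.3)] -/
theorem isLocNil_conjLocImage_sub_one (hns : AcSigned.IsNonsplitIn κ v) (htor : ∀ m : M, ∃ k : ℕ, p ^ k • m = 0)
    (hstab : ∀ m : M, IsOpen (MulAction.stabilizer (absoluteGaloisGroup K) m : Set (absoluteGaloisGroup K))) {γ : absoluteGaloisGroup K} (hγ : κ.IsTopGenerator γ) :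
    IwasawaDual.IsLocNil p (conjLocImage κ M R V j S₀ ε v hres hv S₁ hns γ - 1) := by
  have h := isLocNil_conjStrictAtEnd_sub_one κ R V j S₀ ε v hres hv hns htor hstab hγ
  refine ⟨fun q ↦ ?_, fun q ↦ ?_⟩
  · obtain ⟨s, rfl⟩ := QuotientAddGroup.mk_surjective q
    obtain ⟨k, hk⟩ := h.torsion s
    exact ⟨k, by rw [← QuotientAddGroup.mk_nsmul, hk, QuotientAddGroup.mk_zero]⟩
  · obtain ⟨s, rfl⟩ := QuotientAddGroup.mk_surjective q
    obtain ⟨N, hN⟩ := h.nil s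
    exact ⟨N, by rw [conjLocImage_sub_one_pow_mk, hN, QuotientAddGroup.mk_zero]⟩

/-- **The `Λ`-structure on `Sel_{str,v}^∨ = Hom(Sel_{str,v}, ℚ/ℤ)`** (forced; `T ↦ conj_γ − 1`). [cite: GreenbergLNM1716, §1 (after Conj. 1.3)] -/
@[reducible] def strictAtDualModule (hns : AcSigned.IsNonsplitIn κ v) (htor : ∀ m : M, ∃ k : ℕ, p ^ k • m = 0)
    (hstab : ∀ m : M, IsOpen (MulAction.stabilizer (absoluteGaloisGroup K) m : Set (absoluteGaloisGroup K))) {γ : absoluteGaloisGroup K} (hγ : κ.IsTopGenerator γ) :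
    Module (IwasawaAlgebra p) (strictAt κ M R V j S₀ ε v hres hv →+ AddCircle (1 : ℚ)) :=
  (isLocNil_conjStrictAtEnd_sub_one κ R V j S₀ ε v hres hv hns htor hstab hγ).module

/-- **The `Λ`-structure on `(Sel_{str,v} ⧸ Sel_str)^∨`** (forced; `T ↦ conj_γ − 1`). [cite: GreenbergLNM1716, §1 (after Conj. 1.3)] -/
@[reducible] def locImageDualModule (hns : AcSigned.IsNonsplitIn κ v) (htor : ∀ m : M, ∃ k : ℕ, p ^ k • m = 0)
    (hstab : ∀ m : M, IsOpen (MulAction.stabilizer (absoluteGaloisGroup K) m : Set (absoluteGaloisGroup K))) {γ : absoluteGaloisGroup K} (hγ : κ.IsTopGenerator γ) :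
    Module (IwasawaAlgebra p) (locImageQuot κ M R V j S₀ ε v hres hv S₁ →+ AddCircle (1 : ℚ)) :=
  (isLocNil_conjLocImage_sub_one κ R V j S₀ ε v hres hv S₁ hns htor hstab hγ).module

end LocImage

/-! ## §3. The dual short exact sequence `0 → (Sel_{str,v}/Sel_str)^∨ → Sel_{str,v}^∨ → Y′ → 0` and `Sel_{str,v}^∨ ≅ coker gX` -/

section DualSES

variable {K : Type u} [Field K] [NumberField K] {p : ℕ} [Fact p.Prime] {κ : ZpExtension K p} {γ : absoluteGaloisGroup K}
  {M : Type u} [AddCommGroup M] [DistribMulAction (absoluteGaloisGroup K) M] [TopologicalSpace M] [DiscreteTopology M]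
  {R : Type*} [Ring R] [Module R M] {V : WeierstrassCurve K} {j : V.geomPrimaryTorsion p →+ M} {S₀ : Set (HeightOneSpectrum (𝓞 K))} {ε : ℤˣ}
  (D : SignedTransportDualDataSat κ γ M R V j S₀ ε) {v : HeightOneSpectrum (𝓞 K)} [DistribMulAction (absoluteGaloisGroup (v.adicCompletion K)) M]
  {γv : absoluteGaloisGroup (v.adicCompletion K)} (DQ : LocalCondDualData κ M R V j ε v γv)
  (hres : ∀ (σ : absoluteGaloisGroup (v.adicCompletion K)) (m : M), σ • m = resGalOfEmb (closureEmb (K := K) (v.adicCompletion K)) σ • m)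
  (hv : (p : 𝓞 K) ∈ v.asIdeal) (S₁ : Set (HeightOneSpectrum (𝓞 K))) (hle : strictSelmer κ M R V j S₀ ε S₁ ≤ strictAt κ M R V j S₀ ε v hres hv)
  (hns : AcSigned.IsNonsplitIn κ v) (htor : ∀ m : M, ∃ k : ℕ, p ^ k • m = 0)
  (hstabK : ∀ m : M, IsOpen (MulAction.stabilizer (absoluteGaloisGroup K) m : Set (absoluteGaloisGroup K)))
  (hstab : ∀ m : M, IsOpen (MulAction.stabilizer (absoluteGaloisGroup (v.adicCompletion K)) m : Set (absoluteGaloisGroup (v.adicCompletion K))))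
  (hγ : κ.IsTopGenerator γ) (hγv : κ.IsTopGenerator (resGalOfEmb (closureEmb (K := K) (v.adicCompletion K)) γv))

/-- **`infl : (Sel_{str,v} ⧸ Sel_str)^∨ → Sel_{str,v}^∨`** (precomposition with the quotient map), `Λ`-linear for the forced structures. [cite: Washington1997, §13.2] -/
def inflLinearMap :
    letI := locImageDualModule κ R V j S₀ ε v hres hv S₁ hns htor hstabK hγ; letI := strictAtDualModule κ R V j S₀ ε v hres hv hns htor hstabK hγ
    (locImageQuot κ M R V j S₀ ε v hres hv S₁ →+ AddCircle (1 : ℚ)) →ₗ[IwasawaAlgebra p] (strictAt κ M R V j S₀ ε v hres hv →+ AddCircle (1 : ℚ)) :=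
  letI := locImageDualModule κ R V j S₀ ε v hres hv S₁ hns htor hstabK hγ; letI := strictAtDualModule κ R V j S₀ ε v hres hv hns htor hstabK hγ
  IwasawaDual.dualLinearMap (AddMonoidHom.id _) Function.bijective_id (AddMonoidHom.id _) (QuotientAddGroup.mk' (strictInStrictAt κ M R V j S₀ ε v hres hv S₁))
    (isLocNil_conjStrictAtEnd_sub_one κ R V j S₀ ε v hres hv hns htor hstabK hγ) (isLocNil_conjLocImage_sub_one κ R V j S₀ ε v hres hv S₁ hns htor hstabK hγ)
    (fun _ _ ↦ rfl) (fun _ _ ↦ rfl) fun s ↦ by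
      rw [IwasawaDual.End_sub_apply, IwasawaDual.End_sub_apply, AddMonoid.End.one_apply, AddMonoid.End.one_apply, map_sub]; rfl

/-- Values of `infl`: `infl y s = y [s]`. [folklore] -/
theorem inflLinearMap_apply (y : locImageQuot κ M R V j S₀ ε v hres hv S₁ →+ AddCircle (1 : ℚ)) (s : strictAt κ M R V j S₀ ε v hres hv) :
    inflLinearMap hres hv S₁ hns htor hstabK hγ y s = y (QuotientAddGroup.mk s) := by
  have h := IwasawaDual.toDual_dualHom_apply (AddMonoidHom.id (strictAt κ M R V j S₀ ε v hres hv →+ AddCircle (1 : ℚ))) Function.bijective_id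
    (AddMonoidHom.id (locImageQuot κ M R V j S₀ ε v hres hv S₁ →+ AddCircle (1 : ℚ))) (QuotientAddGroup.mk' (strictInStrictAt κ M R V j S₀ ε v hres hv S₁)) y s
  rw [AddMonoidHom.id_apply, AddMonoidHom.id_apply] at h
  exact h

/-- **`res_v : Sel_{str,v}^∨ → Y′ = Sel_str^∨`** (precomposition with the inclusion `Sel_str ≤ Sel_{str,v}`), `Λ`-linear. [cite: Washington1997, §13.2] -/
def resToStrictLinearMap :
    letI := strictAtDualModule κ R V j S₀ ε v hres hv hns htor hstabK hγ; letI := strictDualModule κ R V j S₀ ε S₁ htor hstabK hγ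
    (strictAt κ M R V j S₀ ε v hres hv →+ AddCircle (1 : ℚ)) →ₗ[IwasawaAlgebra p] (strictSelmer κ M R V j S₀ ε S₁ →+ AddCircle (1 : ℚ)) :=
  letI := strictAtDualModule κ R V j S₀ ε v hres hv hns htor hstabK hγ; letI := strictDualModule κ R V j S₀ ε S₁ htor hstabK hγ
  IwasawaDual.dualLinearMap (AddMonoidHom.id _) Function.bijective_id (AddMonoidHom.id _) (AddSubgroup.inclusion hle)
    (isLocNil_conjStrict_sub_one κ R V j S₀ ε S₁ htor hstabK hγ) (isLocNil_conjStrictAtEnd_sub_one κ R V j S₀ ε v hres hv hns htor hstabK hγ)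
    (fun _ _ ↦ rfl) (fun _ _ ↦ rfl) fun _ ↦ rfl

/-- Values of `res_v`: `res_v y s = y s`. [folklore] -/
theorem resToStrictLinearMap_apply (y : strictAt κ M R V j S₀ ε v hres hv →+ AddCircle (1 : ℚ)) (s : strictSelmer κ M R V j S₀ ε S₁) :
    resToStrictLinearMap hres hv S₁ hle hns htor hstabK hγ y s = y (AddSubgroup.inclusion hle s) := by
  have h := IwasawaDual.toDual_dualHom_apply (AddMonoidHom.id (strictSelmer κ M R V j S₀ ε S₁ →+ AddCircle (1 : ℚ))) Function.bijective_id
    (AddMonoidHom.id (strictAt κ M R V j S₀ ε v hres hv →+ AddCircle (1 : ℚ))) (AddSubgroup.inclusion hle) y s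
  rw [AddMonoidHom.id_apply, AddMonoidHom.id_apply] at h
  exact h

/-- **`res : Dψ.X → Sel_{str,v}^∨`** (`x ↦ toDual x|_{Sel_{str,v}}`), `Λ`-linear. [cite: Washington1997, §13.2] -/
def resAtLinearMap : letI := strictAtDualModule κ R V j S₀ ε v hres hv hns htor hstabK hγ; D.X →ₗ[IwasawaAlgebra p] (strictAt κ M R V j S₀ ε v hres hv →+ AddCircle (1 : ℚ)) :=
  letI := strictAtDualModule κ R V j S₀ ε v hres hv hns htor hstabK hγ
  IwasawaDual.dualLinearMap (AddMonoidHom.id _) Function.bijective_id D.toDual (strictAt κ M R V j S₀ ε v hres hv).subtype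
    (isLocNil_conjStrictAtEnd_sub_one κ R V j S₀ ε v hres hv hns htor hstabK hγ) (isLocNil_conjSignedSat_sub_one κ R V j S₀ ε htor hstabK hγ)
    (fun _ _ ↦ rfl) (fun g y ↦ toDual_smul_eq_smulFun D htor hstabK hγ g y) fun _ ↦ rfl

/-- Values of `res`: `res x s = toDual x s`. [folklore] -/
theorem resAtLinearMap_apply (x : D.X) (s : strictAt κ M R V j S₀ ε v hres hv) :
    resAtLinearMap D hres hv hns htor hstabK hγ x s = D.toDual x (s : signedTransportSelmerInftySat κ M R V j S₀ ε) := by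
  have h := IwasawaDual.toDual_dualHom_apply (AddMonoidHom.id (strictAt κ M R V j S₀ ε v hres hv →+ AddCircle (1 : ℚ))) Function.bijective_id
    D.toDual (strictAt κ M R V j S₀ ε v hres hv).subtype x s
  rw [AddMonoidHom.id_apply] at h
  exact h

/-- `res` is onto (`ℚ/ℤ` injective). [folklore] -/
theorem resAtLinearMap_surjective : Function.Surjective (resAtLinearMap D hres hv hns htor hstabK hγ) := fun y ↦ by
  obtain ⟨x, hx⟩ := IwasawaDual.exists_dualHom_eq_smul (AddMonoidHom.id _) Function.bijective_id D.toDual D.bijective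
    (strictAt κ M R V j S₀ ε v hres hv).subtype (n := 1) (fun s hs ↦ by rw [one_nsmul]; exact Subtype.ext hs) y
  exact ⟨x, by rw [← one_nsmul y]; exact hx⟩

/-- `res_v` is onto (`ℚ/ℤ` injective). [folklore] -/
theorem resToStrictLinearMap_surjective : Function.Surjective (resToStrictLinearMap hres hv S₁ hle hns htor hstabK hγ (M := M)) := fun y ↦ by
  obtain ⟨x, hx⟩ := IwasawaDual.exists_dualHom_eq_smul (AddMonoidHom.id (strictSelmer κ M R V j S₀ ε S₁ →+ AddCircle (1 : ℚ))) Function.bijective_id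
    (AddMonoidHom.id (strictAt κ M R V j S₀ ε v hres hv →+ AddCircle (1 : ℚ))) Function.bijective_id
    (AddSubgroup.inclusion hle) (n := 1) (fun s hs ↦ by rw [one_nsmul]; exact AddSubgroup.inclusion_injective hle (by rw [hs, map_zero])) y
  exact ⟨x, by rw [← one_nsmul y]; exact hx⟩

/-- `infl` is injective (the quotient map is onto). [folklore] -/
theorem inflLinearMap_injective : Function.Injective (inflLinearMap hres hv S₁ hns htor hstabK hγ (M := M) (R := R) (V := V) (j := j) (S₀ := S₀) (ε := ε)) := by
  intro y y' h
  ext q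
  have h' := DFunLike.congr_fun h q
  rw [inflLinearMap_apply, inflLinearMap_apply] at h'
  exact h'

/-- **Exactness at `Sel_{str,v}^∨`**: `ker res_v = range infl` (a character of `Sel_{str,v}` vanishing on `Sel_str` descends to the quotient). [folklore] -/
theorem ker_resToStrict_eq_range_infl :
    letI := strictAtDualModule κ R V j S₀ ε v hres hv hns htor hstabK hγ; letI := strictDualModule κ R V j S₀ ε S₁ htor hstabK hγ
    letI := locImageDualModule κ R V j S₀ ε v hres hv S₁ hns htor hstabK hγ
    LinearMap.ker (resToStrictLinearMap hres hv S₁ hle hns htor hstabK hγ (M := M)) =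
      LinearMap.range (inflLinearMap hres hv S₁ hns htor hstabK hγ (M := M) (R := R) (V := V) (j := j) (S₀ := S₀) (ε := ε)) := by
  letI := strictAtDualModule κ R V j S₀ ε v hres hv hns htor hstabK hγ; letI := strictDualModule κ R V j S₀ ε S₁ htor hstabK hγ
  letI := locImageDualModule κ R V j S₀ ε v hres hv S₁ hns htor hstabK hγ
  ext y
  rw [LinearMap.mem_ker, LinearMap.mem_range]
  constructor
  · intro hy
    refine ⟨QuotientAddGroup.lift (strictInStrictAt κ M R V j S₀ ε v hres hv S₁) y fun s hs ↦ ?_, ?_⟩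
    · have h := (resToStrictLinearMap_apply hres hv S₁ hle hns htor hstabK hγ y ⟨(s : signedTransportSelmerInftySat κ M R V j S₀ ε), hs⟩).symm.trans
        (DFunLike.congr_fun hy ⟨(s : signedTransportSelmerInftySat κ M R V j S₀ ε), hs⟩)
      rw [AddMonoidHom.mem_ker]
      exact h
    · ext s
      exact inflLinearMap_apply hres hv S₁ hns htor hstabK hγ _ s
  · rintro ⟨z, rfl⟩
    ext s
    refine (resToStrictLinearMap_apply hres hv S₁ hle hns htor hstabK hγ _ s).trans ?_
    refine (inflLinearMap_apply hres hv S₁ hns htor hstabK hγ z _).trans ?_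
    rw [AddMonoidHom.zero_apply, (QuotientAddGroup.eq_zero_iff _).mpr (show AddSubgroup.inclusion hle s ∈ strictInStrictAt κ M R V j S₀ ε v hres hv S₁ from s.2), map_zero]

/-- **`ker res = range gX`** (`gX = loc_v^∨`; exactness of `Hom(−, ℚ/ℤ)` on `0 → Sel_{str,v} → Sel → E^{ε}_{sat,v}` and `map_toDual_range_gXHom`). [cite: Kobayashi2003, Thm. 7.3 i)] -/
theorem ker_resAt_eq_range_gX :
    letI := strictAtDualModule κ R V j S₀ ε v hres hv hns htor hstabK hγ
    LinearMap.ker (resAtLinearMap D hres hv hns htor hstabK hγ) = LinearMap.range (gXLinearMap D DQ hres hv htor hstabK hstab hγ hns hγv) := by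
  letI := strictAtDualModule κ R V j S₀ ε v hres hv hns htor hstabK hγ
  have hexact := SmallImageRttCharRoad.exact_compHom'_addCircle (locSat κ M R V j S₀ ε v hres hv).ker.subtype (locSat κ M R V j S₀ ε v hres hv)
    fun a ↦ ⟨fun ha ↦ ⟨⟨a, ha⟩, rfl⟩, by rintro ⟨x, rfl⟩; exact x.2⟩
  ext x
  rw [LinearMap.mem_ker, LinearMap.mem_range]
  have h1 : resAtLinearMap D hres hv hns htor hstabK hγ x = 0 ↔
      AddMonoidHom.compHom' (P := AddCircle (1 : ℚ)) (locSat κ M R V j S₀ ε v hres hv).ker.subtype (D.toDual x) = 0 := by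
    constructor
    · intro h; ext s
      exact (resAtLinearMap_apply D hres hv hns htor hstabK hγ x s).symm.trans (DFunLike.congr_fun h s)
    · intro h; ext s
      exact (resAtLinearMap_apply D hres hv hns htor hstabK hγ x s).trans (DFunLike.congr_fun h s)
  rw [h1, hexact (D.toDual x)]
  constructor
  · rintro ⟨χ, hχ⟩
    have hmem : D.toDual x ∈ (AddMonoidHom.compHom' (P := AddCircle (1 : ℚ)) (locSat κ M R V j S₀ ε v hres hv)).range := ⟨χ, hχ⟩
    rw [← map_toDual_range_gXHom D DQ hres hv] at hmem
    obtain ⟨y, ⟨q, rfl⟩, hy⟩ := hmem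
    exact ⟨q, D.bijective.1 hy⟩
  · rintro ⟨q, rfl⟩
    refine ⟨DQ.toDual q, ?_⟩
    ext s
    rw [gXLinearMap_apply]
    exact (toDual_gXHom_apply D DQ hres hv q s).symm

end DualSES

end Summit.BirchSwinnertonDyer.BirchSwinnertonDyer.Theorems.SmallImageRttD2Seq

end
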